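import Literature.NumberTheory.Automorphic.ArchHeckeTestVectorDualGL2
import Literature.NumberTheory.Automorphic.HeckeEulerFactorisationGL2GammaProduct
import HarnessLib

/-!
# The archimedean Gamma identities `(A_Γ)` for `GL₂(K_∞)` (Jacquet–Langlands (1970), Thm. 5.15, Thm. 6.4,
# proof of Thm. 11.1)

Topic `NumberTheory/Automorphic`; namespace `Literature.NumberTheory.Automorphic`. Theorems only (no
definition, no named fact, no instance).

Main result: `archKirillovGammaProduct` — hypothesis `(A_GP)` of `HeckeEulerFactorisationGL2GammaProduct`: for
every irreducible unitary strongly continuous `τ` of `GL₂(K_∞)` with central character `ω`, every non-zero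
continuous `ψ_∞`-Whittaker functional `ℓ` on its Gårding space and every Haar measure of `K_∞ˣ`, ONE `K_∞`-finite
Gårding vector `e₀` whose two Mellin transforms

  `∫ W_{e₀}(diag(u,1)) N(u)^{s-1/2} d^×u`,  `∫ ω(u⁻¹) W_{τ(w_L)e₀}(diag(u,1)) N(u)^{s-1/2} d^×u`

are Gamma products `A e^{αs} ∏ Γ_ℝ(s+a_j) ∏ Γ_ℂ(s+b_j)` on right half-planes (`exists_testVector_isGammaProduct`).

Proof = assembly of the landed pieces: the base vector (`ArchKirillovBaseVectorNormalFormGL2`), injectivity of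
the Kirillov map on `K_∞`-finite vectors (`ArchKirillovInjectiveKFinite`), the construction of `e₀` with tagged
final types and the rigidity of its Kirillov function (`ArchHeckeTestVectorConstructionGL2`), the dual vector and
the rigidity of the twisted dual Kirillov function (`ArchHeckeTestVectorDualGL2`), separation of variables
(`ArchKirillovFactorisationGL2`) and the Mellin transforms as Gamma products (`KirillovShapeMellinGL2`).

Corollaries (`…_of_archKirillovGammaProduct'`): the named facts `JacquetLanglands1970_standardLTheoryGL2`,
`JacquetLanglands1970_twistedHeckeTheoryGL2 ∧ frobSatakeCompatibleAt_of_isPiOfArtinRep` and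
`frobSatakeCompatibleAt_of_isPiOfArtinRep_of_isUnramifiedAt` hold; the `_holds` discharges live in the sibling
`…Proofs` files of the facts.

## References

* H. Jacquet, R. P. Langlands, *Automorphic Forms on GL(2)*, LNM 114 (1970), §5 Thm. 5.13–5.15, §6
  Thm. 6.2–6.4, §11 proof of Thm. 11.1 (pp. 171–173 of the retypeset edition). [JacquetLanglands1970]
* A. W. Knapp, *Representation Theory of Semisimple Groups* (1986), Ch. VIII. [Knapp1986]
-/

noncomputable section

open MeasureTheory Measure NumberField NumberField.InfinitePlace NumberField.mixedEmbedding IsDedekindDomain Set Filter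
open scoped MatrixGroups Topology Classical InnerProductSpace

namespace Literature.NumberTheory.Automorphic

-- as in `ArchGardingWhittaker`
set_option backward.isDefEq.respectTransparency false


/-! ### 1. Measurability and Mellin transforms of the dual shapes -/

section DualMellin

/-- The twisted dual real shapes are measurable. [folklore] -/
theorem measurable_dualRealShapeOf (μ ν : ℂ) (t : RealTag) : Measurable (dualRealShapeOf μ ν t) := by
  have h2π : (0 : ℝ) < 2 * Real.pi := by positivity
  cases t with
  | discPlus k => exact measurable_realShapeFn 1 0 (continuousOn_expShape ((μ + k) / 2 - μ) (2 * Real.pi))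
  | weightOneSym κ => exact measurable_realShapeFn 1 1 (continuousOn_besselShape ((μ + 1) / 2 - μ) h2π (Complex.I * (-κ - 1 / 2)))
  | weightZero => exact measurable_realShapeFn 1 1 (continuousOn_besselShape (μ / 2 - μ) h2π ν)
  | weightZeroX => exact measurable_realShapeFn 1 1 (continuousOn_besselShape (μ / 2 + 1 - μ) h2π ν)

/-- The twisted dual complex shapes are measurable. [folklore] -/
theorem measurable_dualComplexShapeOf (μ₁ : ℂ) (m : ℕ) (ν ν' : ℂ) (t : ComplexTag) : Measurable (dualComplexShapeOf μ₁ m ν ν' t) := by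
  have h4π : (0 : ℝ) < 4 * Real.pi := by positivity
  cases t with
  | holPow b => exact measurable_radial (continuousOn_besselShape ((μ₁ + m + 1) / 2 + b - μ₁) h4π ν')
  | antiPowLowest b => exact measurable_radial (continuousOn_besselShape ((μ₁ + m + 1) / 2 + b - μ₁) h4π ν)
  | string j => exact measurable_radial (continuousOn_besselShape ((μ₁ + m + 1) / 2 - μ₁) h4π (ν - Complex.I * ((m - j : ℕ) : ℂ)))

/-- **Mellin transforms of the twisted dual real shapes are Gamma products.** [cite: JacquetLanglands1970, §5 Thm. 5.15] -/
theorem mellin_dualRealShapeOf (μ ν : ℂ) (t : RealTag) : ∃ x₀ : ℝ,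
    (∀ s : ℂ, x₀ < s.re → Integrable fun u : ℝ => dualRealShapeOf μ ν t u * ((|u| : ℝ) : ℂ) ^ (s - 3 / 2)) ∧
    IsGammaProduct x₀ (fun s => ∫ u : ℝ, dualRealShapeOf μ ν t u * ((|u| : ℝ) : ℂ) ^ (s - 3 / 2)) := by
  have h2π : (0 : ℝ) < 2 * Real.pi := by positivity
  have h10 : (1 : ℂ) + 0 ≠ 0 := by norm_num
  have h11 : (1 : ℂ) + 1 ≠ 0 := by norm_num
  cases t with
  | discPlus k => exact ⟨_, isGammaProduct_mellin_expShape h2π ((μ + k) / 2 - μ) h10⟩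
  | weightOneSym κ => exact ⟨_, isGammaProduct_mellin_besselShape h2π ((μ + 1) / 2 - μ) (Complex.I * (-κ - 1 / 2)) h11⟩
  | weightZero => exact ⟨_, isGammaProduct_mellin_besselShape h2π (μ / 2 - μ) ν h11⟩
  | weightZeroX => exact ⟨_, isGammaProduct_mellin_besselShape h2π (μ / 2 + 1 - μ) ν h11⟩

/-- **Mellin transforms over `ℂ` of the twisted dual complex shapes are Gamma products.** [cite: JacquetLanglands1970, §6 Thm. 6.4] -/
theorem mellin_dualComplexShapeOf (μ₁ : ℂ) (m : ℕ) (ν ν' : ℂ) (t : ComplexTag) : ∃ x₀ : ℝ,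
    (∀ s : ℂ, x₀ < s.re → Integrable fun z : ℂ => dualComplexShapeOf μ₁ m ν ν' t z * ((‖z‖ ^ 2 : ℝ) : ℂ) ^ (s - 3 / 2)) ∧
    IsGammaProduct x₀ (fun s => ∫ z : ℂ, dualComplexShapeOf μ₁ m ν ν' t z * ((‖z‖ ^ 2 : ℝ) : ℂ) ^ (s - 3 / 2)) := by
  have h4π : (0 : ℝ) < 4 * Real.pi := by positivity
  cases t with
  | holPow b => exact ⟨_, isGammaProduct_mellin_complexBesselShape h4π ((μ₁ + m + 1) / 2 + b - μ₁) ν'⟩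
  | antiPowLowest b => exact ⟨_, isGammaProduct_mellin_complexBesselShape h4π ((μ₁ + m + 1) / 2 + b - μ₁) ν⟩
  | string j => exact ⟨_, isGammaProduct_mellin_complexBesselShape h4π ((μ₁ + m + 1) / 2 - μ₁) (ν - Complex.I * ((m - j : ℕ) : ℂ))⟩

end DualMellin

/-! ### 2. The test vector and its two Mellin transforms -/

section TestVector

attribute [local instance] Literature.MeasureTheory.Group.Units.borelSpace_of_isOpenEmbedding

variable {K : Type} [Field K] [NumberField K] {hcpt : isCompact_glFiniteIntegralLevel 2 K}
  {E : Type*} [NormedAddCommGroup E] [InnerProductSpace ℂ E] [CompleteSpace E]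
  {τ : ContRepresentation ℂ (AutomorphyDatum.gl 2 K hcpt).arch.carrier E}

/-- A square root: every `c` is `c = a - 2ν²` for some `ν`. [folklore] -/
theorem exists_eq_sub_two_mul_sq (a c : ℂ) : ∃ ν : ℂ, c = a - 2 * ν ^ 2 := by
  refine ⟨((a - c) / 2) ^ (((2 : ℕ) : ℂ)⁻¹), ?_⟩
  rw [Complex.cpow_nat_inv_pow _ two_ne_zero]; ring

/-- **The archimedean Hecke test vector**: for an irreducible unitary `τ` with central character `ω` and a non-zero
continuous Whittaker functional `ℓ`, a non-zero `K_∞`-finite Gårding vector `e₀` whose two Mellin transforms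
`∫ W_{e₀}(diag(u,1)) N(u)^{s-1/2} dμ` and `∫ ω(u⁻¹) W_{τ(w_L)e₀}(diag(u,1)) N(u)^{s-1/2} dμ` (any Haar measure `μ` of
`K_∞ˣ`, Mathlib's σ-algebra) are Gamma products on right half-planes.
[cite: JacquetLanglands1970, §5 Thm. 5.15, §6 Thm. 6.4, proof of Thm. 11.1 (pp. 171–173)] -/
theorem exists_testVector_isGammaProduct (hτ : τ.IsStronglyContinuous) (hτu : τ.IsUnitary) (hτi : τ.IsTopIrreducible)
    {ω : (mixedSpace K)ˣ → ℂ} (hω : ∀ (c : (mixedSpace K)ˣ) (v : E), τ (toArch hcpt (glDiagonal 2 (mixedSpace K) fun _ => c)) v = ω c • v)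
    {ℓ : archGardingSpace hcpt τ →ₗ[ℂ] ℂ} (hℓW : IsArchContWhittakerFunctional hcpt τ hτ ℓ) (hne : ℓ ≠ 0)
    (μ : Measure (mixedSpace K)ˣ) [μ.IsHaarMeasure] :
    ∃ e₀ : archGardingSpace hcpt τ, e₀ ∈ archKFinite hτ ∧ e₀ ≠ 0 ∧
      (∃ x₀ : ℝ, IsGammaProduct x₀ (fun s => ∫ u : (mixedSpace K)ˣ, kirillovFn hτ ℓ e₀ u *
        ((mixedEmbedding.norm ((u : (mixedSpace K)ˣ) : mixedSpace K) : ℝ) : ℂ) ^ (s - 1 / 2) ∂μ)) ∧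
      ∃ x₀ : ℝ, IsGammaProduct x₀ (fun s => ∫ u : (mixedSpace K)ˣ, ω u⁻¹ * kirillovFn hτ ℓ (gardingAct hτ (weylLong 2 (mixedSpace K)) e₀) u *
        ((mixedEmbedding.norm ((u : (mixedSpace K)ˣ) : mixedSpace K) : ℝ) : ℂ) ^ (s - 1 / 2) ∂μ) := by
  -- the real signs
  set δf : {w : InfinitePlace K // IsReal w} → GL (Fin 2) (mixedSpace K) := fun w => realPlaceGL K w reflGLR with hδf_def
  have hδf : ∀ w, (δf w : Matrix (Fin 2) (Fin 2) (mixedSpace K)) = 1 - (2 : ℝ) • Matrix.single (0 : Fin 2) (0 : Fin 2) ((Pi.single w 1, 0) : mixedSpace K) :=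
    fun w => coe_realPlaceGL_reflGLR (K := K) w
  -- the scalars of the places
  choose μR hμR using fun w => exists_realCentral hτ hτu hτi w
  choose lamR hlamR using fun w => exists_placeCasimirReal_gardingEnd_eq_smul hτ hτu hτi w
  choose νR hνR using fun w => exists_eq_sub_two_mul_sq (μR w ^ 2 / 2 - 1 / 2) (lamR w)
  have hνR' : ∀ w, lamR w = μR w ^ 2 / 2 - 2 * νR w ^ 2 - 1 / 2 := fun w => by rw [hνR w]; ring
  choose μ₁ hZ1 using fun w => (exists_complexCentral hτ hτu hτi w).1
  choose μ₂ hZ2 using fun w => (exists_complexCentral hτ hτu hτi w).2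
  choose lamh hCh using fun w => (exists_placeCasimirHolAnti_gardingEnd_eq_smul hτ hτu hτi w).1
  choose lama hCa using fun w => (exists_placeCasimirHolAnti_gardingEnd_eq_smul hτ hτu hτi w).2
  choose νC' hνC' using fun w => exists_eq_sub_two_mul_sq ((μ₁ w - Complex.I * μ₂ w) ^ 2 / 2 - 2) (lamh w)
  have hlamh : ∀ w, lamh w = (μ₁ w - Complex.I * μ₂ w) ^ 2 / 2 - 2 * νC' w ^ 2 - 2 := fun w => by rw [hνC' w]; ring
  choose sC hsC using fun w => exists_gardingAct_diagGL2_self_eq_smul hτ hτu hτi (complexUnitAt K w (-1))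
  -- the base vector and the exact relations
  obtain ⟨x, k, m, hbc, hk0, hsign, hone, htwo, hdesc⟩ := exists_isBaseCandidate_normalForm' hτ hτu hτi hℓW hne hδf
  have hx0 : x ≠ 0 := hbc.ne_zero
  have hxK : x ∈ archKFinite hτ := hbc.kFinite
  have hnull : ∀ v ∈ archKFinite hτ, v ∈ kirillovNull hτ ℓ → v = 0 := fun v hv hvS => by
    by_contra h; exact not_mem_kirillovNull_of_mem_archKFinite hτ hτu hτi hℓW hne hv h hvS
  have hsC0 : ∀ w, sC w ≠ 0 := fun w h0 => hx0 (by
    have h1 := hsC w x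
    rw [h0, zero_smul] at h1
    rw [← Module.End.one_apply (R := ℂ) x, ← gardingAct_one (hcpt := hcpt) (τ := τ) hτ, ← inv_mul_cancel (diagGL2 (complexUnitAt K w (-1)) (complexUnitAt K w (-1))),
      gardingAct_mul, Module.End.mul_apply, h1, map_zero])
  obtain ⟨kx, hkx⟩ : ∃ kx : {w : InfinitePlace K // IsReal w} → ℕ, ∀ w, ((kx w : ℕ) : ℤ) = k w :=
    ⟨fun w => (k w).toNat, fun w => Int.toNat_of_nonneg (hk0 w)⟩
  have hkcast : ∀ w, ((kx w : ℕ) : ℂ) = (k w : ℂ) := fun w => by rw [← hkx w]; norm_cast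
  have hLoK : ∀ w, (gardingEnd hτ (Matrix.single (0 : Fin 2) (0 : Fin 2) ((Pi.single w 1, 0) : mixedSpace K) - Matrix.single (1 : Fin 2) (1 : Fin 2) ((Pi.single w 1, 0) : mixedSpace K)) -
      Complex.I • gardingEnd hτ (Matrix.single (0 : Fin 2) (1 : Fin 2) ((Pi.single w 1, 0) : mixedSpace K) + Matrix.single (1 : Fin 2) (0 : Fin 2) ((Pi.single w 1, 0) : mixedSpace K))) x ∈
      archKFinite hτ := fun w =>
    Submodule.sub_mem _ (gardingEnd_mem_archKFinite hτ _ hxK) (Submodule.smul_mem _ _ (gardingEnd_mem_archKFinite hτ _ hxK))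
  have hRraw : ∀ w, RealRaw hτ w (δf w) x (kx w) (2 * lamR w - μR w ^ 2 + 1) := by
    intro w
    refine ⟨by rw [hkcast]; exact hbc.weylR w, fun hk => hsign w (by rw [← hkx w, hk]; rfl), fun hk => ?_⟩
    rcases Nat.lt_or_ge 1 (kx w) with h2 | h2
    · have hk2 : 2 ≤ k w := by rw [← hkx w]; exact_mod_cast h2
      exact Or.inl (hnull _ (hLoK w) (htwo w hk2))
    · have hk1 : kx w = 1 := le_antisymm h2 hk
      have hk1' : k w = 1 := by rw [← hkx w, hk1]; rfl
      rcases hone w hk1' with h3 | h3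
      · refine Or.inr ⟨hk1, fun hsR => h3 ?_⟩
        have h4 := raising_lowering_apply hτ w 1 (μR w) (lamR w) x (by rw [mul_one]; have := hbc.weylR w; rwa [hk1', Int.cast_one, mul_one] at this)
          (hμR w x) (hlamR w x)
        rw [h4, show 2 * lamR w - μR w ^ 2 - 1 ^ 2 + 2 * 1 = 2 * lamR w - μR w ^ 2 + 1 by ring, hsR, zero_smul]
      · exact Or.inl (hnull _ (hLoK w) h3)
  have hCraw : ∀ w, ComplexRaw hτ w x (m w) := fun w =>
    ⟨hbc.raising w, hbc.torusC w, fun hm => hnull _ (descentOp_mem_archKFinite hτ w _ hxK) (hdesc w hm)⟩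
  -- the Bessel parameters of the complex places, with the string relation
  have hνC_ex : ∀ w, ∃ ν : ℂ, lama w = (μ₁ w + Complex.I * μ₂ w) ^ 2 / 2 - 2 * ν ^ 2 - 2 ∧
      (2 ≤ m w → lamh w = (μ₁ w - Complex.I * μ₂ w) ^ 2 / 2 - 2 * (ν - Complex.I * m w) ^ 2 - 2) := by
    intro w
    by_cases hm : 2 ≤ m w
    · obtain ⟨ν, h1, h2⟩ := exists_string_relation hτu hτi hℓW hne (hZ1 w) (hZ2 w) (hCa w) (hCh w) hxK hx0 (hCraw w) hm
      exact ⟨ν, h1, fun _ => h2⟩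
    · obtain ⟨ν, hν⟩ := exists_eq_sub_two_mul_sq ((μ₁ w + Complex.I * μ₂ w) ^ 2 / 2 - 2) (lama w)
      exact ⟨ν, by rw [hν]; ring, fun h => absurd h hm⟩
  choose νC hlama hrelm using hνC_ex
  have hrel : ∀ w (j : ℕ), 0 < j → j < m w → lamh w = (μ₁ w - Complex.I * μ₂ w) ^ 2 / 2 - 2 * (νC w - Complex.I * m w) ^ 2 - 2 :=
    fun w j hj hjm => hrelm w (by omega)
  -- the test vector
  obtain ⟨e, heK, he0, hRF, hCF, -⟩ := exists_final_of_raw (hτ := hτ) hτu hτi hℓW hne hδf hμR hlamR hZ2 hxK hx0 hRraw hCraw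
  choose tagR htagR using fun w => exists_realTag (hRF w)
  choose tagC htagC using fun w => exists_complexTag (hCF w)
  refine ⟨e, heK, he0, ?_, ?_⟩
  · -- the direct Mellin transform
    have hrigR : ∀ w, RigidRealAt (kirillovFn hτ ℓ e) w (realShapeOf (μR w) (νR w) (tagR w)) := fun w =>
      RealTagged.rigid hτu hℓW (hδf w) (νR w) (hνR' w) (htagR w)
    have hrigC : ∀ w, RigidComplexAt (kirillovFn hτ ℓ e) w (complexShapeOf (μ₁ w) (m w) (νC w) (νC' w) (tagC w)) := fun w =>
      ComplexTagged.rigid hτu hℓW (hlama w) (hlamh w) (hZ1 w) (hZ2 w) (hCa w) (hCh w) (hrel w) (htagC w)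
    obtain ⟨C, hC⟩ := exists_eq_const_mul_prod_of_rigid hrigR hrigC
    have hC0 : C ≠ 0 := by
      intro h0
      refine not_mem_kirillovNull_of_mem_archKFinite hτ hτu hτi hℓW hne heK he0 fun u => ?_
      rw [hC u, h0, zero_mul]
    choose xF hF using fun w => mellin_realShapeOf (μR w) (νR w) (tagR w)
    choose xG hG using fun w => mellin_complexShapeOf (μ₁ w) (m w) (νC w) (νC' w) (tagC w)
    obtain ⟨x₀, -, hΓ⟩ := isGammaProduct_mellin_units_of_prod K μ _ _ xF xG (fun w => measurable_realShapeOf _ _ _)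
      (fun w => measurable_complexShapeOf _ _ _ _ _) hF hG hC0 _ hC
    exact ⟨x₀, hΓ⟩
  · -- the dual Mellin transform
    obtain ⟨hrigR, hrigC⟩ := rigid_twisted_dual_kirillovFn hτ hω hτu hℓW hνR' hμR hlama hlamh hZ1 hZ2 hCa hCh hrel hsC hsC0 tagR tagC he0 htagR htagC
    obtain ⟨C, hC⟩ := exists_eq_const_mul_prod_of_rigid hrigR hrigC
    have hC0 : C ≠ 0 := by
      intro h0
      have hwK : gardingAct hτ (weylLong 2 (mixedSpace K)) e ∈ archKFinite hτ := gardingAct_mem_archKFinite hτ weylLong_mem_Kinf heK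
      have hw0 : gardingAct hτ (weylLong 2 (mixedSpace K)) e ≠ 0 := fun h1 => he0 (by
        rw [← Module.End.one_apply (R := ℂ) e, ← gardingAct_one (hcpt := hcpt) (τ := τ) hτ, ← inv_mul_cancel (weylLong 2 (mixedSpace K)),
          gardingAct_mul, Module.End.mul_apply, h1, map_zero])
      refine not_mem_kirillovNull_of_mem_archKFinite hτ hτu hτi hℓW hne hwK hw0 fun u => ?_
      have h1 := hC u
      rw [h0, zero_mul, mul_eq_zero] at h1
      rcases h1 with h1 | h1
      · exfalso
        have h2 := (centralChar_mul hτ hω he0).2.2 u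
        rw [h1, zero_mul] at h2
        exact zero_ne_one h2
      · exact h1
    choose xF hF using fun w => mellin_dualRealShapeOf (μR w) (νR w) (tagR w)
    choose xG hG using fun w => mellin_dualComplexShapeOf (μ₁ w) (m w) (νC w) (νC' w) (tagC w)
    obtain ⟨x₀, -, hΓ⟩ := isGammaProduct_mellin_units_of_prod K μ _ _ xF xG (fun w => measurable_dualRealShapeOf _ _ _)
      (fun w => measurable_dualComplexShapeOf _ _ _ _ _) hF hG hC0 _ hC
    refine ⟨x₀, ?_⟩
    simpa only [mul_assoc] using hΓ

end TestVector

/-! ### 3. The archimedean Gamma products `(A_GP)` and the named facts -/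

section Gamma

attribute [local instance] Literature.MeasureTheory.Group.Units.borelSpace_of_isOpenEmbedding

/-- **`(A_GP)` — Jacquet–Langlands (1970), Thm. 5.15 (ii)–(iv) / Thm. 6.4 for ONE `K_∞`-finite test vector, in
Gamma-product form**: hypothesis of `HeckeEulerFactorisationGL2GammaProduct`.
[cite: JacquetLanglands1970, Thm. 5.15, Thm. 6.4, proof of Thm. 11.1 (pp. 171–173)] -/
theorem archKirillovGammaProduct : ∀ (K : Type) [Field K] [NumberField K] (hcpt : isCompact_glFiniteIntegralLevel 2 K)
      (μ : Measure (AdelicGroupData.gl 2 K).automorphicQuotient) [(AdelicGroupData.gl 2 K).IsAutomorphicMeasure μ]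
      (Pl : CuspidalAutomorphicRepGL 2 K μ)
      (E : Type) [NormedAddCommGroup E] [InnerProductSpace ℂ E] [CompleteSpace E]
      (τ : ContRepresentation ℂ (AutomorphyDatum.gl 2 K hcpt).arch.carrier E) (hτ : τ.IsStronglyContinuous)
      (_ : τ.IsUnitary) (_ : τ.IsTopIrreducible) (_ : ∃ T ∈ archIntertwiners hcpt τ Pl.1, T ≠ 0)
      (ω : (mixedSpace K)ˣ → ℂ) (_ : ∀ c, ‖ω c‖ = 1)
      (_ : ∀ (c : (mixedSpace K)ˣ) (v : E), τ (toArch hcpt (glDiagonal 2 (mixedSpace K) fun _ => c)) v = ω c • v)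
      (ℓ : archGardingSpace hcpt τ →ₗ[ℂ] ℂ) (_ : IsArchContWhittakerFunctional hcpt τ hτ ℓ) (_ : ℓ ≠ 0)
      [MeasurableSpace ((mixedSpace K)ˣ)] [BorelSpace ((mixedSpace K)ˣ)]
      (μ' : Measure ((mixedSpace K)ˣ)) (_ : IsHaarMeasure μ'),
      ∃ (e₀ : archGardingSpace hcpt τ)
        (_ : FiniteDimensional ℂ (Submodule.span ℂ (Set.range
          fun κ : (AutomorphyDatum.gl 2 K hcpt).arch.maximalCompact =>
            τ (toArch hcpt (κ : GL (Fin 2) (mixedSpace K))) (e₀ : E)))) (x₀ x₀' : ℝ),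
        IsGammaProduct x₀ (fun s => ∫ u : (mixedSpace K)ˣ, kirillovFn hτ ℓ e₀ u *
            ((mixedEmbedding.norm ((u : (mixedSpace K)ˣ) : mixedSpace K) : ℝ) : ℂ) ^ (s - 1 / 2) ∂μ') ∧
        IsGammaProduct x₀' (fun s => ∫ u : (mixedSpace K)ˣ,
            ω u⁻¹ * kirillovFn hτ ℓ (gardingAct hτ (weylLong 2 (mixedSpace K)) e₀) u *
              ((mixedEmbedding.norm ((u : (mixedSpace K)ˣ) : mixedSpace K) : ℝ) : ℂ) ^ (s - 1 / 2) ∂μ') := by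
  intro K _ _ hcpt μA _ Pl E _ _ _ τ hτ hτu hτi _ ω _ hω ℓ hℓW hne mS hB μ' hμ'
  -- the σ-algebra is Mathlib's (both are Borel)
  have hmS : mS = Units.instMeasurableSpace :=
    (BorelSpace.measurable_eq (α := (mixedSpace K)ˣ)).trans
      (@BorelSpace.measurable_eq (mixedSpace K)ˣ _ Units.instMeasurableSpace Literature.MeasureTheory.Group.Units.borelSpace_of_isOpenEmbedding).symm
  subst hmS
  haveI := hμ'
  obtain ⟨e₀, heK, -, ⟨x₁, h₁⟩, ⟨x₂, h₂⟩⟩ := exists_testVector_isGammaProduct hτ hτu hτi hω hℓW hne μ'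
  -- `K_∞`-finiteness
  have hfin : FiniteDimensional ℂ (Submodule.span ℂ (Set.range fun κ : (AutomorphyDatum.gl 2 K hcpt).arch.maximalCompact =>
      τ (toArch hcpt (κ : GL (Fin 2) (mixedSpace K))) (e₀ : E))) := by
    obtain ⟨V, hVfd, hK, heV⟩ := (mem_archKFinite_iff hτ).mp heK
    haveI := hVfd
    refine Submodule.finiteDimensional_of_le (Submodule.span_le.mpr ?_ : _ ≤ V.map (archGardingSpace hcpt τ).subtype)
    rintro _ ⟨κ, rfl⟩
    exact ⟨gardingAct hτ (κ : GL (Fin 2) (mixedSpace K)) e₀, hK _ κ.2 _ heV, rfl⟩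
  exact ⟨e₀, hfin, x₁, x₂, h₁, h₂⟩

/-- **Jacquet–Langlands (1970), Thm. 11.1 / Cor. 11.2** — the named fact `JacquetLanglands1970_standardLTheoryGL2` holds.
[cite: JacquetLanglands1970, Thm. 11.1, Cor. 11.2, Thm. 5.15, Thm. 6.4] -/
theorem standardLTheoryGL2_of_archKirillovGammaProduct' : JacquetLanglands1970_standardLTheoryGL2 :=
  JacquetLanglands1970_standardLTheoryGL2_of_archKirillovGammaProduct archKirillovGammaProduct

/-- The Galois-twisted Hecke theory and its `π`-unramified companion hold.
[cite: JacquetLanglands1970, Thm. 11.1, Cor. 11.2] [cite: Gelbart1997, Prop. 4.1] -/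
theorem twistedHeckeTheoryGL2_and_frobSatakeCompatibleAt_of_archKirillovGammaProduct' :
    JacquetLanglands1970_twistedHeckeTheoryGL2 ∧ frobSatakeCompatibleAt_of_isPiOfArtinRep :=
  JacquetLanglands1970_twistedHeckeTheoryGL2_and_frobSatakeCompatibleAt_of_archKirillovGammaProduct archKirillovGammaProduct

/-- Gelbart (1997), Prop. 4.1 at the `σ`-unramified places holds. [cite: Gelbart1997, Prop. 4.1] -/
theorem frobSatakeCompatibleAt_of_isUnramifiedAt_of_archKirillovGammaProduct' :
    frobSatakeCompatibleAt_of_isPiOfArtinRep_of_isUnramifiedAt :=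
  frobSatakeCompatibleAt_of_isPiOfArtinRep_of_isUnramifiedAt_of_archKirillovGammaProduct archKirillovGammaProduct

/-! #### By-name discharges
The harness's by-name census (`<Fact>_holds`) of the two named facts proved just above under descriptive
names; same proofs, canonical names. -/

/-- **Jacquet–Langlands (1970), Thm. 11.1 / Cor. 11.2: the standard `L`-theory of cuspidal `GL₂`** — by-name
discharge of the named fact `JacquetLanglands1970_standardLTheoryGL2`.
[cite: JacquetLanglands1970, Thm. 11.1, Cor. 11.2, Thm. 5.15, Thm. 6.4] -/
theorem JacquetLanglands1970_standardLTheoryGL2_holds : JacquetLanglands1970_standardLTheoryGL2 :=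
  JacquetLanglands1970_standardLTheoryGL2_of_archKirillovGammaProduct archKirillovGammaProduct

/-- **Gelbart (1997), Prop. 4.1 at the `σ`-unramified places** — by-name discharge of the named fact
`frobSatakeCompatibleAt_of_isPiOfArtinRep_of_isUnramifiedAt`. [cite: Gelbart1997, Prop. 4.1]
[cite: JacquetLanglands1970, Thm. 11.1, Cor. 11.2] -/
theorem frobSatakeCompatibleAt_of_isPiOfArtinRep_of_isUnramifiedAt_holds :
    frobSatakeCompatibleAt_of_isPiOfArtinRep_of_isUnramifiedAt :=
  frobSatakeCompatibleAt_of_isPiOfArtinRep_of_isUnramifiedAt_of_archKirillovGammaProduct archKirillovGammaProduct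

end Gamma

end Literature.NumberTheory.Automorphic
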